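import Literature.AnabelianGeometry.AbsoluteAnabelian.MonoidKummerMapsTLGLiftReduction
import Literature.AnabelianGeometry.AbsoluteAnabelian.MonoidKummerMapsMonoAnalyticLiftHolds
import Literature.AnabelianGeometry.AbsoluteAnabelian.MLFGaloisTFGProofs
import Literature.NumberTheory.GaloisRepresentations.CohomologicalDimension
import Literature.NumberTheory.GaloisRepresentations.AbsGaloisGroup
import Literature.IUT.HodgeTheaters.CoveringsErrata
import HarnessLib

/-!
# [AbsTopIII] Prop 3.2 (iv) / Prop 3.3 (ii): the `TLG` lifting sentence for ALL MLF-Galois pairs,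
# modulo the Nikolov–Segal theorem BY NAME (abc-iut FACT-LIST F-0412 / F-0409 / F-0413 ⇐ F-1977)

Proof-only companion (theorems only, no new definitions) of abc-iut-L4-t2's `MonoidKummerMaps.lean`
(S. Mochizuki, *Topics in Absolute Anabelian Geometry III*, Prop. 3.2 (iv) p. 72 with proof
pp. 72–73, Prop. 3.3 (ii) p. 74; kurims manuscript, lit key `paper:url-5493eb38cbb7`).

abc-iut-L6-d1's `MonoidKummerMapsTLGLiftReduction.lean` reduced every surjectivity sentence of that
file to the field-level bi-anabelian statement for ABSTRACT isomorphisms of absolute Galois groups,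

  (BA_abs) for MLFs `k₁, k₂` with algebraic closures and every isomorphism of GROUPS
           `α : Gal(k̄₁/k₁) ⥲ Gal(k̄₂/k₂)` there is an `α`-equivariant `β : k̄₁^× ⥲ k̄₂^×`,

and this seat's `MonoidKummerMapsMonoAnalyticLiftHolds.lean` PROVED the topological form (BA)
(`biAnabelianUnits_holds`, local class field theory).  The gap (BA_abs) − (BA) is exactly
"abstract isomorphisms between absolute Galois groups of MLFs are continuous".  This file closes it
MODULO ONE NAMED FACT, consumed by name and NOT proved here:

* `Literature.IUT.HodgeTheaters.Rmk253.FiniteIndexOpenOfTopFG` (abc-iut FACT-LIST F-1977) — the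
  theorem of Nikolov–Segal quoted in [IUTchI] Rmk. 2.5.3 (vi): in a topologically finitely generated
  profinite group every finite-index subgroup is open;

applied to `H := Gal(k̄/k)`, which IS topologically finitely generated
(`isTopologicallyFinitelyGenerated_absoluteGaloisGroup_of_localEPC`, [NSW] Thm. 7.5.10, proved in
`MLFGaloisTFGProofs.lean` modulo Tate's local Euler–Poincaré characteristic
`localEulerPoincareCharacteristic`, itself proved Summits-side — hence the second hypothesis `hEP`
of the Literature-side statements below; the Summits-side companion
`Summits/ABC/IUTFork/MonoidKummerMapsLiftsOfFiniteIndexOpen.lean` discharges it).  Then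
`Rmk253.continuous_of_forall_finiteIndex_isOpen` makes every abstract isomorphism of such Galois
groups an isomorphism of topological groups, and (BA) applies.

Results (hypotheses `hNS : FiniteIndexOpenOfTopFG.{0}`, `hEP`):
* (private) `forall_finiteIndex_isOpen_of_continuousMulEquiv`,
  `exists_continuousMulEquiv_of_mulEquiv_of_forall_finiteIndex_isOpen` — generic plumbing;
* `forall_finiteIndex_isOpen_absoluteGaloisGroup_of_finiteIndexOpenOfTopFG` — finite-index subgroups
  of `Gal(k̄/k)` are open (`k` a `p`-adic local field);
* `exists_galoisContinuousMulEquiv_of_mulEquiv_of_finiteIndexOpenOfTopFG` — an abstract isomorphism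
  of absolute Galois groups of MLFs (arbitrary algebraic closures, `MLFClosure`) is topological;
* `biAnabelianUnits_abstract_of_finiteIndexOpenOfTopFG` — (BA_abs);
* `tlgLifting_of_finiteIndexOpenOfTopFG`, `tcgLifting_of_finiteIndexOpenOfTopFG` — the `TLG` / `TCG`
  lifting sentences for ALL MLF-Galois pairs and all admissible `Π ⥲ Π*` (not only compact `Π`, not
  only pairs of mono-analytic type);
* `unitPairIsoFibres_of_finiteIndexOpenOfTopFG_of_localEPC` — F-0412 `UnitPairIsoFibres`;
  `galoisIsoLiftsToTMPairIso_of_finiteIndexOpenOfTopFG_of_localEPC` — F-0409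
  `GaloisIsoLiftsToTMPairIso H` for EVERY hypothesis predicate `H`;
  `unitPairIsoFibresOfType_of_finiteIndexOpenOfTopFG_of_localEPC` — F-0413
  `UnitPairIsoFibresOfType H` for every `H`.

WHY THE RESIDUAL IS HONEST: the typed `TLG` lifting sentence ranges over ALL MLF-Galois pairs of
[AbsTopIII] Def. 3.1 (i)/(ii) as typed (`ModelMLFGaloisData`: ANY topological group `Π` with a
continuous surjection onto `Gal(k̄/k)`, e.g. `Gal(k̄/k)` with the discrete topology), so it contains
(BA_abs), and an `α`-equivariant `β` forces `α` to carry the open stabilisers `Gal(k̄/k(x))` onto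
open stabilisers — i.e. the fact implies the continuity of abstract isomorphisms of such Galois
groups, a statement of Nikolov–Segal type.  HONEST FRAMING: OUR kernel check of a reduction between
statements of refereed papers plus classical local Galois theory; a FACT consumed by name is an
assumption label, not an endorsement; nothing here bears on [IUTchIII] Cor. 3.12 or asserts anything
about abc.

## References

* S. Mochizuki, *Topics in Absolute Anabelian Geometry III*, Prop. 3.2 (iv), 3.3 (ii).
  [MochizukiAbsTopIII2015]
* N. Nikolov, D. Segal, *Finite index subgroups in profinite groups*, C. R. Acad. Sci. Paris 337
  (2003) — quoted in [IUTchI] Rmk. 2.5.3 (vi). [Mochizuki2012]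
* J. Neukirch, A. Schmidt, K. Wingberg, *Cohomology of Number Fields* (2008), Thm. 7.5.10.
  [NeukirchSchmidtWingberg2008]
-/

noncomputable section

open scoped nonZeroDivisors

namespace Literature.AnabelianGeometry.AbsoluteAnabelian

open Field
open Literature.NumberTheory.GaloisRepresentations (algEquivContinuousMulEquivAbsoluteGaloisGroup
  localEulerPoincareCharacteristic)
open Literature.IUT.HodgeTheaters.Rmk253 (FiniteIndexOpenOfTopFG continuous_of_forall_finiteIndex_isOpen)

universe u

/-! ### §1. Generic plumbing: "finite-index subgroups are open" -/

/-- "Every finite-index subgroup is open" is transported along isomorphisms of topological groups.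
[folklore] -/
private theorem forall_finiteIndex_isOpen_of_continuousMulEquiv {G H : Type*} [Group G] [TopologicalSpace G]
    [Group H] [TopologicalSpace H] (e : G ≃ₜ* H)
    (hG : ∀ U : Subgroup G, U.FiniteIndex → IsOpen (U : Set G)) (V : Subgroup H)
    (hV : V.FiniteIndex) : IsOpen (V : Set H) := by
  have h1 : (V.comap e.toMulEquiv.toMonoidHom).FiniteIndex := by
    rw [Subgroup.finiteIndex_iff, Subgroup.index_comap_of_surjective _ e.toMulEquiv.surjective]
    exact Subgroup.finiteIndex_iff.mp hV
  have h2 : IsOpen ((V.comap e.toMulEquiv.toMonoidHom : Subgroup G) : Set G) := hG _ h1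
  have h3 : (V : Set H) = e.symm ⁻¹' ((V.comap e.toMulEquiv.toMonoidHom : Subgroup G) : Set G) := by
    ext x
    change x ∈ V ↔ e (e.symm x) ∈ V
    rw [ContinuousMulEquiv.apply_symm_apply]
  rw [h3]
  exact h2.preimage e.symm.continuous

/-- An abstract group isomorphism between profinite (compact, totally disconnected) topological
groups all of whose finite-index subgroups are open is an isomorphism of topological groups (both
`α` and `α⁻¹` are continuous by `Rmk253.continuous_of_forall_finiteIndex_isOpen`). [folklore] -/
private theorem exists_continuousMulEquiv_of_mulEquiv_of_forall_finiteIndex_isOpen {G H : Type u} [Group G]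
    [TopologicalSpace G] [IsTopologicalGroup G] [CompactSpace G] [TotallyDisconnectedSpace G]
    [Group H] [TopologicalSpace H] [IsTopologicalGroup H] [CompactSpace H] [TotallyDisconnectedSpace H]
    (hG : ∀ U : Subgroup G, U.FiniteIndex → IsOpen (U : Set G))
    (hH : ∀ U : Subgroup H, U.FiniteIndex → IsOpen (U : Set H)) (α : G ≃* H) :
    ∃ α' : G ≃ₜ* H, ∀ g, α' g = α g :=
  ⟨{ α with
      continuous_toFun := continuous_of_forall_finiteIndex_isOpen hG α.toMonoidHom
      continuous_invFun := continuous_of_forall_finiteIndex_isOpen hH α.symm.toMonoidHom },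
    fun _ => rfl⟩

/-! ### §2. The absolute Galois group of a `p`-adic local field -/

section Local

variable (k : Type) [Field k] [ValuativeRel k] [TopologicalSpace k] [IsNonarchimedeanLocalField k]
  [CharZero k]

/-- **Finite-index subgroups of `Gal(k̄/k)` are open** (`k` a non-archimedean local field of
characteristic `0`), FROM the Nikolov–Segal theorem BY NAME (`FiniteIndexOpenOfTopFG`, [IUTchI]
Rmk. 2.5.3 (vi)) applied to the topologically finitely generated profinite group `Gal(k̄/k)`
([NSW] Thm. 7.5.10, `isTopologicallyFinitelyGenerated_absoluteGaloisGroup_of_localEPC`, modulo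
Tate's local Euler–Poincaré characteristic `hEP`).
[cite: NeukirchSchmidtWingberg2008, Thm. 7.5.10] [cite: Mochizuki2012, IUTchI Rmk 2.5.3 (vi) (O3) p.56] -/
theorem forall_finiteIndex_isOpen_absoluteGaloisGroup_of_finiteIndexOpenOfTopFG
    (hNS : FiniteIndexOpenOfTopFG.{0}) (hEP : localEulerPoincareCharacteristic k)
    (U : Subgroup (absoluteGaloisGroup k)) (hU : U.FiniteIndex) :
    IsOpen (U : Set (absoluteGaloisGroup k)) :=
  hNS (ProfiniteGrp.of (absoluteGaloisGroup k))
    (isTopologicallyFinitelyGenerated_absoluteGaloisGroup_of_localEPC k hEP) U hU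

end Local

/-! ### §3. Arbitrary algebraic closures: abstract isomorphisms of `Gal(k̄/k)` are topological -/

/-- Finite-index subgroups of `Aut_k(K)` are open for every MLF closure datum `(k, K = k̄)`
(transport of §2 along the tree's `algEquivContinuousMulEquivAbsoluteGaloisGroup`).
[cite: NeukirchSchmidtWingberg2008, Thm. 7.5.10] -/
theorem forall_finiteIndex_isOpen_gal_of_finiteIndexOpenOfTopFG (hNS : FiniteIndexOpenOfTopFG.{0})
    (C : MLFClosure.{0}) (hEP : localEulerPoincareCharacteristic C.k)
    (U : Subgroup (C.K ≃ₐ[C.k] C.K)) (hU : U.FiniteIndex) : IsOpen (U : Set (C.K ≃ₐ[C.k] C.K)) :=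
  forall_finiteIndex_isOpen_of_continuousMulEquiv
    (algEquivContinuousMulEquivAbsoluteGaloisGroup C.k C.K).symm
    (forall_finiteIndex_isOpen_absoluteGaloisGroup_of_finiteIndexOpenOfTopFG C.k hNS hEP) U hU

/-- **Abstract isomorphisms of absolute Galois groups of MLFs are topological** (modulo
Nikolov–Segal BY NAME and Tate's Euler–Poincaré characteristic): every isomorphism of GROUPS
`Aut_{k₁}(k̄₁) ⥲ Aut_{k₂}(k̄₂)` is (the underlying map of) an isomorphism of topological groups.
[cite: Mochizuki2012, IUTchI Rmk 2.5.3 (vi) (O3) p.56] [cite: NeukirchSchmidtWingberg2008, Thm. 7.5.10] -/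
theorem exists_galoisContinuousMulEquiv_of_mulEquiv_of_finiteIndexOpenOfTopFG
    (hNS : FiniteIndexOpenOfTopFG.{0}) (C₁ C₂ : MLFClosure.{0})
    (hEP₁ : localEulerPoincareCharacteristic C₁.k) (hEP₂ : localEulerPoincareCharacteristic C₂.k)
    (α : (C₁.K ≃ₐ[C₁.k] C₁.K) ≃* (C₂.K ≃ₐ[C₂.k] C₂.K)) :
    ∃ α' : (C₁.K ≃ₐ[C₁.k] C₁.K) ≃ₜ* (C₂.K ≃ₐ[C₂.k] C₂.K), ∀ σ, α' σ = α σ := by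
  let e₁ := algEquivContinuousMulEquivAbsoluteGaloisGroup C₁.k C₁.K
  let e₂ := algEquivContinuousMulEquivAbsoluteGaloisGroup C₂.k C₂.K
  let α₀ : absoluteGaloisGroup C₁.k ≃* absoluteGaloisGroup C₂.k :=
    e₁.symm.toMulEquiv.trans (α.trans e₂.toMulEquiv)
  obtain ⟨α₀', hα₀'⟩ := exists_continuousMulEquiv_of_mulEquiv_of_forall_finiteIndex_isOpen
    (forall_finiteIndex_isOpen_absoluteGaloisGroup_of_finiteIndexOpenOfTopFG C₁.k hNS hEP₁)
    (forall_finiteIndex_isOpen_absoluteGaloisGroup_of_finiteIndexOpenOfTopFG C₂.k hNS hEP₂) α₀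
  refine ⟨e₁.trans (α₀'.trans e₂.symm), fun σ => ?_⟩
  show e₂.symm (α₀' (e₁ σ)) = α σ
  rw [hα₀']
  show e₂.symm (e₂ (α (e₁.symm (e₁ σ)))) = α σ
  rw [ContinuousMulEquiv.symm_apply_apply, ContinuousMulEquiv.symm_apply_apply]

/-! ### §4. (BA_abs) and the lifting sentences -/

/-- **(BA_abs) modulo Nikolov–Segal BY NAME**: for MLF closure data `C₁, C₂` and every ABSTRACT
isomorphism `α` of the Galois groups there is an `α`-equivariant multiplicative bijection
`β : k̄₁^× ⥲ k̄₂^×` — the hypothesis of abc-iut-L6-d1's `tlgLifting_of_biAnabelianUnits_abstract`,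
from (BA) (`biAnabelianUnits_holds`, local class field theory) and §3.
[cite: MochizukiAbsTopIII2015, Proposition 3.2 (iv) p.72] -/
theorem biAnabelianUnits_abstract_of_finiteIndexOpenOfTopFG (hNS : FiniteIndexOpenOfTopFG.{0})
    (hEP : ∀ (F : Type) [Field F] [ValuativeRel F] [TopologicalSpace F] [IsNonarchimedeanLocalField F]
      [CharZero F], localEulerPoincareCharacteristic F)
    (C₁ C₂ : MLFClosure.{0}) (α : (C₁.K ≃ₐ[C₁.k] C₁.K) ≃* (C₂.K ≃ₐ[C₂.k] C₂.K)) :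
    ∃ β : (C₁.K)⁰ ≃* (C₂.K)⁰, ∀ (σ : C₁.K ≃ₐ[C₁.k] C₁.K) (x y : (C₁.K)⁰), (y : C₁.K) = σ x →
      ((β y : (C₂.K)⁰) : C₂.K) = α σ ((β x : (C₂.K)⁰) : C₂.K) := by
  obtain ⟨α', hα'⟩ := exists_galoisContinuousMulEquiv_of_mulEquiv_of_finiteIndexOpenOfTopFG hNS C₁ C₂
    (hEP C₁.k) (hEP C₂.k) α
  obtain ⟨β, hβ⟩ := biAnabelianUnits_holds C₁ C₂ α'
  exact ⟨β, fun σ x y h => by rw [hβ σ x y h, hα']⟩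

/-- **The `TLG` lifting sentence for ALL MLF-Galois `TLG`-pairs** ([AbsTopIII] Prop. 3.3 (ii)
surjectivity), modulo Nikolov–Segal BY NAME and Tate's Euler–Poincaré characteristic: every
admissible isomorphism of topological groups `Π ⥲ Π*` (carrying the arithmetic kernel onto the
arithmetic kernel) lifts to an isomorphism of pairs.
[cite: MochizukiAbsTopIII2015, Proposition 3.3 (ii) p.74] -/
theorem tlgLifting_of_finiteIndexOpenOfTopFG (hNS : FiniteIndexOpenOfTopFG.{0})
    (hEP : ∀ (F : Type) [Field F] [ValuativeRel F] [TopologicalSpace F] [IsNonarchimedeanLocalField F]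
      [CharZero F], localEulerPoincareCharacteristic F)
    (P Q : GaloisMonoidPair.{0}) (hP : IsMLFGaloisMonoidPair .TLG P) (hQ : IsMLFGaloisMonoidPair .TLG Q)
    (f : P.Pi ≃ₜ* Q.Pi) (hf : P.actionKer.map f.toMulEquiv.toMonoidHom = Q.actionKer) :
    ∃ e : GaloisMonoidPair.Iso P Q, e.isoPi = f :=
  tlgLifting_of_biAnabelianUnits_abstract (biAnabelianUnits_abstract_of_finiteIndexOpenOfTopFG hNS hEP)
    P Q hP hQ f hf

/-- **The `TCG` lifting sentence for ALL MLF-Galois `TCG`-pairs** ([AbsTopIII] Prop. 3.3 (ii)),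
modulo Nikolov–Segal BY NAME and Tate's Euler–Poincaré characteristic.
[cite: MochizukiAbsTopIII2015, Proposition 3.3 (ii) p.74] -/
theorem tcgLifting_of_finiteIndexOpenOfTopFG (hNS : FiniteIndexOpenOfTopFG.{0})
    (hEP : ∀ (F : Type) [Field F] [ValuativeRel F] [TopologicalSpace F] [IsNonarchimedeanLocalField F]
      [CharZero F], localEulerPoincareCharacteristic F)
    (P Q : GaloisMonoidPair.{0}) (hP : IsMLFGaloisMonoidPair .TCG P) (hQ : IsMLFGaloisMonoidPair .TCG Q)
    (f : P.Pi ≃ₜ* Q.Pi) (hf : P.actionKer.map f.toMulEquiv.toMonoidHom = Q.actionKer) :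
    ∃ e : GaloisMonoidPair.Iso P Q, e.isoPi = f :=
  tcgLifting_of_biAnabelianUnits_abstract (biAnabelianUnits_abstract_of_finiteIndexOpenOfTopFG hNS hEP)
    P Q hP hQ f hf

/-- **F-0412 `UnitPairIsoFibres` ([AbsTopIII] Prop. 3.3 (ii), the pre-erratum named fact of
abc-iut-L4-t2) modulo Nikolov–Segal BY NAME** (and Tate's Euler–Poincaré characteristic, discharged
Summits-side): both conjuncts, for all MLF-Galois `TLG`/`TCG`-pairs.
[cite: MochizukiAbsTopIII2015, Proposition 3.3 (ii) p.74] -/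
theorem unitPairIsoFibres_of_finiteIndexOpenOfTopFG_of_localEPC (hNS : FiniteIndexOpenOfTopFG.{0})
    (hEP : ∀ (F : Type) [Field F] [ValuativeRel F] [TopologicalSpace F] [IsNonarchimedeanLocalField F]
      [CharZero F], localEulerPoincareCharacteristic F) :
    Literature.AnabelianGeometry.AbsoluteAnabelian.UnitPairIsoFibres :=
  unitPairIsoFibres_of_biAnabelianUnits_abstract (biAnabelianUnits_abstract_of_finiteIndexOpenOfTopFG hNS hEP)

/-- **F-0409 `GaloisIsoLiftsToTMPairIso H` for EVERY hypothesis predicate `H`** ([AbsTopIII]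
Prop. 3.2 (iv) in the author's corrected form) modulo Nikolov–Segal BY NAME (and Tate's
Euler–Poincaré characteristic) — not only for predicates forcing `Π` compact
(`galoisIsoLiftsToTMPairIso_of_compact_holds`).
[cite: MochizukiAbsTopIII2015, Proposition 3.2 (iv) p.72] [cite: MochizukiAbsTopIIIComments2019, item (5)] -/
theorem galoisIsoLiftsToTMPairIso_of_finiteIndexOpenOfTopFG_of_localEPC (hNS : FiniteIndexOpenOfTopFG.{0})
    (hEP : ∀ (F : Type) [Field F] [ValuativeRel F] [TopologicalSpace F] [IsNonarchimedeanLocalField F]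
      [CharZero F], localEulerPoincareCharacteristic F)
    (H : GaloisMonoidPair.{0} → Prop) :
    Literature.AnabelianGeometry.AbsoluteAnabelian.GaloisIsoLiftsToTMPairIso H :=
  galoisIsoLiftsToTMPairIso_of_biAnabelianUnits_abstract
    (biAnabelianUnits_abstract_of_finiteIndexOpenOfTopFG hNS hEP) H

/-- **F-0413 `UnitPairIsoFibresOfType H` for EVERY hypothesis predicate `H`** ([AbsTopIII]
Prop. 3.3 (ii) as corrected, both clauses) modulo Nikolov–Segal BY NAME (and Tate's Euler–Poincaré
characteristic).
[cite: MochizukiAbsTopIII2015, Proposition 3.3 (ii) p.74] [cite: MochizukiAbsTopIIIComments2019, item (5)] -/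
theorem unitPairIsoFibresOfType_of_finiteIndexOpenOfTopFG_of_localEPC (hNS : FiniteIndexOpenOfTopFG.{0})
    (hEP : ∀ (F : Type) [Field F] [ValuativeRel F] [TopologicalSpace F] [IsNonarchimedeanLocalField F]
      [CharZero F], localEulerPoincareCharacteristic F)
    (H : GaloisMonoidPair.{0} → Prop) :
    Literature.AnabelianGeometry.AbsoluteAnabelian.UnitPairIsoFibresOfType H :=
  unitPairIsoFibresOfType_of_biAnabelianUnits_abstract
    (biAnabelianUnits_abstract_of_finiteIndexOpenOfTopFG hNS hEP) H

end Literature.AnabelianGeometry.AbsoluteAnabelian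

end
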